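import Summits.QuantumFields.YangMills.Theorems.ColdStartUniversalityLatticeLangevinTimeDecorrelationUniform
import HarnessLib

/-!
# Route `ColdStartUniversality` (fixed-cut-off SZZ dynamics): the mean-square ergodic theorem holds for EVERY realisation —
# a jointly measurable solution flow exists on every space, and time averages are realisation-independent by pathwise uniqueness

Helper file (seat `ym-line-csu-p1`, g33; `--supports stmt-QuantumFields-24809`).  Files 49–50 bound the mean-square error of time averages
`T⁻¹∫₀ᵀ G(U_r) dr` for JOINTLY MEASURABLE strong solutions (Fubini on `Ω × (0,T]²`).  Here the hypothesis is removed: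
* ★ `exists_flow_measurable_uncurry` — on every probability space with a flat Brownian driver there is a solution family from every start whose
  members are jointly measurable in `(t, ω)` (the regular flow of `exists_regularFlow`, progressive measurability glued by `measurable_uncurry_of_prog`);
* ★★★ `integral_sq_timeAverage_sub_wilson_le_of_solution` — for EVERY strong solution `U'` from a deterministic start on ANY space, every bounded
  measurable `G`, `|G| ≤ 1`, every `T > 0`: `E[(T⁻¹∫₀ᵀ G(U'_r) dr − μ_(β')(G))²] ≤ 4C/(cT)` (every coupling; Harris constants) — `U'` is indistinguishable
  from the jointly measurable solution from the same start (`latticeLangevin_pathwise_unique`), so its time averages coincide almost surely;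
* ★★★ `integral_sq_timeAverage_sub_wilson_le_uniform_of_solution` — the volume-free version for local `C⁵` observables at `|β'| < 1/12`:
  `≤ 8·M·C_f/(ρT)`, every `L`.
THEOREMS ONLY, no definition, no sorry; [folklore].  HONEST FRAMING: fixed cut-off; `UniformColdStartMixing` (24809) is NOT restated; no crux, rung
or summit statement is proved; the Yang–Mills mass gap is NOT proved.
-/

set_option autoImplicit false

noncomputable section

namespace Summit.QuantumFields.YangMills.Theorems.ColdStartUniversality.LiebRobinson

open MeasureTheory ProbabilityTheory Matrix Complex Finset Filter Set Metric
open scoped ComplexConjugate BigOperators Matrix NNReal ENNReal Topology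
open Literature.Probability.Process Literature.MathematicalPhysics.QuantumFieldTheory
open Literature.MathematicalPhysics.QuantumFieldTheory.Balaban1983to89
open Literature.MathematicalPhysics.QuantumLattice (fundamentalRep fundamentalLatticeRep continuous_fundamentalRep fundamentalRep_apply)

variable {L : ℕ} [NeZero L]

/-! ## §1. A jointly measurable solution flow on every space -/

/-- ★ **Jointly measurable strong solutions from every start exist on every space.**  On every probability space carrying a flat Brownian
motion there is a family `U` of strong solutions of the SU(2) SZZ dynamics, `U x` started at `x`, with `(t, ω) ↦ U x t ω` measurable for every
`x` (the regular flow; progressive measurability glued over `t ≤ n`). [folklore] -/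
theorem exists_flow_measurable_uncurry (L : ℕ) [NeZero L] (β' : ℝ)
    {Ω : Type} [MeasurableSpace Ω] {P : Measure Ω} [IsProbabilityMeasure P]
    {W : ℝ≥0 → Ω → (Edge 3 L × NoiseIdx 2 → ℝ)} (hW : IsFlatBrownian W P) :
    ∃ U : GaugeConfig 3 L (Matrix.specialUnitaryGroup (Fin 2) ℂ) → ℝ≥0 → Ω → GaugeConfig 3 L (Matrix.specialUnitaryGroup (Fin 2) ℂ),
      ∀ x, (∀ ω, U x 0 ω = x) ∧
        (latticeLangevinDynamics (fundamentalLatticeRep 2) β').IsSolution (fundamentalRep (Fin 2)) hW.natFiltration P W (U x) ∧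
        Measurable (Function.uncurry (U x)) := by
  classical
  haveI := secondCountableTopology_su2
  haveI := borelSpace_config L
  obtain ⟨U, -, hU, hprog, -, -, -⟩ := exists_regularFlow L β' hW
  refine ⟨U, fun x => ⟨(hU x).1, (hU x).2, ?_⟩⟩
  -- progressive measurability at the ambient σ-algebra, frozen at the start `x`
  have hZ : ∀ n : ℕ, Measurable[@Prod.instMeasurableSpace (Set.Iic (n : ℝ≥0)) Ω inferInstance inferInstance]
      (fun q : Set.Iic (n : ℝ≥0) × Ω => U x q.1 q.2) := by
    intro n
    have h1 : Measurable[@Prod.instMeasurableSpace (Set.Iic (n : ℝ≥0))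
        (GaugeConfig 3 L (Matrix.specialUnitaryGroup (Fin 2) ℂ) × Ω) inferInstance inferInstance]
        (fun q : Set.Iic (n : ℝ≥0) × (GaugeConfig 3 L (Matrix.specialUnitaryGroup (Fin 2) ℂ) × Ω) => U q.2.1 q.1 q.2.2) :=
      (hprog n).mono (sup_le_sup le_rfl (MeasurableSpace.comap_mono (sup_le_sup le_rfl
        (MeasurableSpace.comap_mono (hW.natFiltration.le n))))) le_rfl
    have h2 : Measurable fun q : Set.Iic (n : ℝ≥0) × Ω => (q.1, (x, q.2)) := measurable_fst.prodMk (measurable_const.prodMk measurable_snd)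
    exact h1.comp h2
  have h := measurable_uncurry_of_prog (Z := U x) (fun _ => (inferInstance : MeasurableSpace Ω)) (fun _ => le_rfl) hZ
  have h3 : Measurable fun p : ℝ≥0 × Ω => (p.2, (p.1 : ℝ)) := measurable_snd.prodMk (measurable_fst.coe_nnreal_real)
  have h4 := h.comp h3
  have hfun : (Function.uncurry (U x)) = (fun q : Ω × ℝ => U x q.2.toNNReal q.1) ∘ (fun p : ℝ≥0 × Ω => (p.2, (p.1 : ℝ))) := by
    funext p
    simp [Function.uncurry, Real.toNNReal_coe]
  rw [hfun]
  exact h4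

/-! ## §2. The mean-square ergodic theorem for every realisation -/

/-- ★★★ **Mean-square ergodic theorem for EVERY strong solution** (every coupling; `C, c` depend on `L, β'`; no joint-measurability hypothesis):
for every strong solution `U'` of the SU(2) SZZ dynamics from a deterministic start on ANY probability space, every bounded measurable `G` with
`|G| ≤ 1` and every `T > 0`, `E[(T⁻¹∫_(0,T] G(U'_r) dr − μ_(β')(G))²] ≤ 4C/(c·T)`. [folklore] -/
theorem integral_sq_timeAverage_sub_wilson_le_of_solution (L : ℕ) [NeZero L] (β' : ℝ) :
    ∃ C c : ℝ, 0 < C ∧ 0 < c ∧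
      ∀ (x : GaugeConfig 3 L (Matrix.specialUnitaryGroup (Fin 2) ℂ))
        (Ω : Type) [MeasurableSpace Ω] (P : Measure Ω) [IsProbabilityMeasure P]
        (W : ℝ≥0 → Ω → (Edge 3 L × NoiseIdx 2 → ℝ)) (hW : IsFlatBrownian W P)
        (U' : ℝ≥0 → Ω → GaugeConfig 3 L (Matrix.specialUnitaryGroup (Fin 2) ℂ)),
        (∀ ω, U' 0 ω = x) →
        (latticeLangevinDynamics (fundamentalLatticeRep 2) β').IsSolution (fundamentalRep (Fin 2)) hW.natFiltration P W U' →
        ∀ (G : GaugeConfig 3 L (Matrix.specialUnitaryGroup (Fin 2) ℂ) → ℝ), Measurable G → (∀ z, |G z| ≤ 1) →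
        ∀ (T : ℝ), 0 < T →
          ∫ ω, (T⁻¹ * (∫ r in Ioc 0 T, G (U' r.toNNReal ω)) - ∫ z, G z ∂(wilsonMeasure (d := 3) (L := L) (fundamentalRep (Fin 2)) β')) ^ 2 ∂P ≤
            4 * C / (c * T) := by
  obtain ⟨C, c, hC, hc, h⟩ := integral_sq_timeAverage_sub_wilson_le L β'
  refine ⟨C, c, hC, hc, fun x Ω _ P _ W hW U' hU'0 hU' G hG hG1 T hT => ?_⟩
  obtain ⟨U, hU⟩ := exists_flow_measurable_uncurry L β' hW
  have hmain := h x Ω P W hW (U x) (hU x).1 (hU x).2.1 (hU x).2.2 G hG hG1 T hT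
  -- `U'` and `U x` are indistinguishable, so their time averages agree almost surely
  have hae := latticeLangevin_pathwise_unique hW β' x hU'0 (hU x).1 hU' (hU x).2.1
  refine le_of_eq_of_le (integral_congr_ae ?_) hmain
  filter_upwards [hae] with ω hω
  have hfun : (fun r : ℝ => G (U' r.toNNReal ω)) = fun r : ℝ => G (U x r.toNNReal ω) := funext fun r => by rw [hω]
  simp only [hfun]

/-- ★★★ **Volume-free mean-square ergodic theorem for EVERY strong solution, local observables, `|β'| < 1/12`**: for every torus size `L`, every
strong solution `U'` from a deterministic start on any space, every `C⁵` local observable `f` with link-Lipschitz profile `ℓ ≥ 0` supported in `Λ`,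
`|f∘coords| ≤ M`, and every `T > 0`: `E[(T⁻¹∫_(0,T] f∘coords(U'_r) dr − μ_(β')(f∘coords))²] ≤ 8·M·C_f/(ρT)`, `C_f = 12π#Λ√(Σℓ²)(6(7+6λ/ρ)³+2)`,
`ρ = 1 − 12|β'|`. [folklore] -/
theorem integral_sq_timeAverage_sub_wilson_le_uniform_of_solution (L : ℕ) [NeZero L] (β' : ℝ) (hβ : |β'| < 1 / 12)
    (x : GaugeConfig 3 L (Matrix.specialUnitaryGroup (Fin 2) ℂ))
    {Ω : Type} [MeasurableSpace Ω] {P : Measure Ω} [IsProbabilityMeasure P]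
    {W : ℝ≥0 → Ω → (Edge 3 L × NoiseIdx 2 → ℝ)} (hW : IsFlatBrownian W P)
    {U' : ℝ≥0 → Ω → GaugeConfig 3 L (Matrix.specialUnitaryGroup (Fin 2) ℂ)} (hU'0 : ∀ ω, U' 0 ω = x)
    (hU' : (latticeLangevinDynamics (fundamentalLatticeRep 2) β').IsSolution (fundamentalRep (Fin 2)) hW.natFiltration P W U')
    {f : (Edge 3 L × Fin 2 × Fin 2 × Bool → ℝ) → ℝ} (hf : ContDiff ℝ 5 f) (Λ : Finset (Edge 3 L)) {ℓ : Edge 3 L → ℝ} (hℓ : ∀ e, 0 ≤ ℓ e)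
    (hℓΛ : ∀ e, e ∉ Λ → ℓ e = 0) {M : ℝ} {T : ℝ} (hT : 0 < T) :
    let coords : GaugeConfig 3 L (Matrix.specialUnitaryGroup (Fin 2) ℂ) → (Edge 3 L × Fin 2 × Fin 2 × Bool → ℝ) :=
      fun V q => (fun z : ℂ => if q.2.2.2 then z.im else z.re)
        ((fundamentalRep (Fin 2) (V q.1) : Matrix (Fin 2) (Fin 2) ℂ) q.2.1 q.2.2.1)
    (∀ (e : Edge 3 L) (y y' : (GaugeConfig 3 L (Matrix.specialUnitaryGroup (Fin 2) ℂ))), (∀ g, g ≠ e → y g = y' g) →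
      |f (coords y) - f (coords y')| ≤ ℓ e * frobNorm ((y e : Matrix (Fin 2) (Fin 2) ℂ) - (y' e : Matrix (Fin 2) (Fin 2) ℂ))) →
    (∀ y : (GaugeConfig 3 L (Matrix.specialUnitaryGroup (Fin 2) ℂ)), |f (coords y)| ≤ M) →
    ∫ ω, (T⁻¹ * (∫ r in Ioc 0 T, f (coords (U' r.toNNReal ω))) - ∫ y, f (coords y) ∂(wilsonMeasure (d := 3) (L := L) (fundamentalRep (Fin 2)) β')) ^ 2 ∂P ≤
      8 * M * (12 * Real.pi * Λ.card * Real.sqrt (∑ e : Edge 3 L, ℓ e ^ 2) * (6 * (7 + 6 * ((1300 + 4 * Real.sqrt 2) * |β'|) / (1 - 12 * |β'|)) ^ 3 + 2)) /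
        ((1 - 12 * |β'|) * T) := by
  intro coords hLip hM
  obtain ⟨U, hU⟩ := exists_flow_measurable_uncurry L β' hW
  have hmain := integral_sq_timeAverage_sub_wilson_le_uniform_of_linkLipschitz L β' hβ x hW (hU x).1 (hU x).2.1 (hU x).2.2 hf Λ hℓ hℓΛ
    (M := M) hT hLip hM
  have hae := latticeLangevin_pathwise_unique hW β' x hU'0 (hU x).1 hU' (hU x).2.1
  refine le_of_eq_of_le (integral_congr_ae ?_) hmain
  filter_upwards [hae] with ω hω
  have hfun : (fun r : ℝ => f (coords (U' r.toNNReal ω))) = fun r : ℝ => f (coords (U x r.toNNReal ω)) := funext fun r => by rw [hω]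
  simp only [hfun, coords]

end Summit.QuantumFields.YangMills.Theorems.ColdStartUniversality.LiebRobinson

end
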